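import Summits.ABC.StewartYu.GenThreeVanishingPoints
import HarnessLib

/-!
# Gen-3 engines ⇒ the zero estimate, V: the point set `Σ_X` in the two conventions of the cell

`Summits/ABC/StewartYu/GenThreeVanishingSigma.lean` — cell `abc-stewartyu` (route `PadicPrimesKummerThird`,
cruxes `Y07Odd` stmt-ABC-19658 / `Y07Two` stmt-ABC-19659), seat p3 (g4).  Theorems only.

p3's V package (`GenThreeVanishing{,Points,Orbit,Shift}`) writes the points as powers `θ^x` of
`θ = (ofAdd c, ξ) ∈ 𝔾ₐ × 𝔾ₘ^m`; p4's E package (`NesterenkoZeroEnd`, statement block 2026-08-26T18:21Z) and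
the interface sheet `plan/m3/ZE-INTERFACE.md` write them as `(ofAdd (x : ℂ), fun j => ξ j ^ x)`.  With
`c = 1` these are the same points (`zpow_base_eq`), hence the same set `Σ_X` (`zpowSet_eq_sigmaSet`), so the
two packages compose without an adapter.
-/

noncomputable section

open Literature.NumberTheory.Transcendental
open Literature.NumberTheory.Transcendental.GaGm

namespace Summit.ABC.StewartYu.GenThreeVanishing

variable {m : ℕ}

/-- `(c, ξ)^x = (x·c, ξ^x)` in `𝔾ₐ × 𝔾ₘ^m`. [folklore] -/
theorem zpow_base_eq_general (c : ℂ) (ξ : Fin m → ℂˣ) (x : ℤ) :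
    ((Multiplicative.ofAdd c, ξ) : GaGm m) ^ x =
      (Multiplicative.ofAdd ((x : ℂ) * c), fun j => ξ j ^ x) := by
  ext j
  · show Multiplicative.toAdd ((Multiplicative.ofAdd c) ^ x) = Multiplicative.toAdd (Multiplicative.ofAdd ((x : ℂ) * c))
    rw [toAdd_zpow, toAdd_ofAdd, toAdd_ofAdd, zsmul_eq_mul]
  · rfl

/-- `(1, ξ)^x = (x, ξ^x)` in `𝔾ₐ × 𝔾ₘ^m` — p3's `θ^x` with `c = 1` is p4's / the interface sheet's point.
[folklore] -/
theorem zpow_base_eq (ξ : Fin m → ℂˣ) (x : ℤ) :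
    ((Multiplicative.ofAdd (1 : ℂ), ξ) : GaGm m) ^ x =
      (Multiplicative.ofAdd (x : ℂ), fun j => ξ j ^ x) := by
  rw [zpow_base_eq_general, mul_one]

/-- **`Σ_X` in the two conventions coincide** (`c = 1`):
`{θ^x : |x| ≤ X} = {(x, ξ^x) : |x| ≤ X}`. [folklore] -/
theorem zpowSet_eq_sigmaSet (ξ : Fin m → ℂˣ) (X : ℕ) :
    {g : GaGm m | ∃ x : ℤ, |x| ≤ (X : ℤ) ∧ g = ((Multiplicative.ofAdd (1 : ℂ), ξ) : GaGm m) ^ x} =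
      {g : GaGm m | ∃ x : ℤ, |x| ≤ (X : ℤ) ∧
        g = ((Multiplicative.ofAdd (x : ℂ), fun j => ξ j ^ x) : GaGm m)} := by
  ext g
  simp only [Set.mem_setOf_eq, zpow_base_eq]

/-- Membership form of the same identification (the shape of p4's hypothesis `hS`). [folklore] -/
theorem mem_zpowSet_iff (ξ : Fin m → ℂˣ) (X : ℕ) (g : GaGm m) :
    g ∈ {g : GaGm m | ∃ x : ℤ, |x| ≤ (X : ℤ) ∧ g = ((Multiplicative.ofAdd (1 : ℂ), ξ) : GaGm m) ^ x} ↔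
      ∃ x : ℤ, |x| ≤ (X : ℤ) ∧ g = ((Multiplicative.ofAdd (x : ℂ), fun j => ξ j ^ x) : GaGm m) := by
  rw [zpowSet_eq_sigmaSet]
  rfl

end Summit.ABC.StewartYu.GenThreeVanishing

end
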